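import Mathlib
import Summits.MatrixMultiplication.MatrixMultiplication.Theorems.FidelityWitnessesFidelityGapTwoSixExplicitKernel

/-!
# `FidelityGapTwoSixExplicit` — the spectral gap of the slice contraction on alternating arrays

Part of the proof of `FidelityWitnesses.FidelityGapTwoSixExplicit` (stmt-MatrixMultiplication-14041); see
`FidelityWitnessesFidelityGapTwoSixExplicitDefs.lean` for the line of argument.  Here: the Hermitian-form
machinery (weighted sums of square moduli of INTEGER linear forms are Hermitian double sums with an
integer matrix; matrices are compared by the kernel, `decide +kernel`), and with it the gap inequality
`‖z − kerProj z‖² ≤ 2 Σ_{c,a} |sliceMap z (c,a)|²` for alternating arrays `z` (the compression of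
`sliceMap* ∘ sliceMap` to the alternating arrays has spectrum `{0, 1/2, 3/2}` with kernel `kerSpan`;
the `3/2`-eigenvectors enter as four explicit integer linear forms).
-/

noncomputable section

namespace Summit.MatrixMultiplication.MatrixMultiplication.Theorems.GapTwoSixExplicit

-- single-conjunct summit: the `Summit.<S>.<P>` prefix repeats `MatrixMultiplication` by design (D-0017)
set_option linter.dupNamespace false

open scoped BigOperators ComplexConjugate InnerProductSpace
open Literature.Computability.AlgebraicComplexity

/-! ## Hermitian forms with integer coefficient matrices

The quantitative identities of the proof are identities `Σ_t r_t |L_t(w)|² = Σ_s r'_s |L'_s(w)|²` between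
weighted sums of squares of linear forms with INTEGER coefficients; both sides are
`Σ_{p,q} M(p,q) conj(w_p) w_q` for an integer matrix `M`, and the matrices are compared by `decide`. -/

/-- The square modulus of an integer linear form as a Hermitian double sum. [folklore] -/
theorem conj_linform_mul_linform {ι : Type} [Fintype ι] (c : ι → ℤ) (w : ι → ℂ) :
    conj (∑ p, (c p : ℂ) * w p) * (∑ p, (c p : ℂ) * w p)
      = ∑ p, ∑ q, ((c p * c q : ℤ) : ℂ) * (conj (w p) * w q) := by
  rw [map_sum, Finset.sum_mul_sum]
  refine Finset.sum_congr rfl fun p _ => Finset.sum_congr rfl fun q _ => ?_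
  simp only [map_mul, map_intCast]
  push_cast
  ring

/-- A weighted sum of square moduli of integer linear forms as ONE Hermitian double sum. [folklore] -/
theorem sum_weight_conj_linform_mul_linform {ι κ : Type} [Fintype ι] [Fintype κ] (r : κ → ℤ)
    (c : κ → ι → ℤ) (w : ι → ℂ) :
    (∑ t, (r t : ℂ) * (conj (∑ p, (c t p : ℂ) * w p) * (∑ p, (c t p : ℂ) * w p)))
      = ∑ p, ∑ q, ((∑ t, r t * (c t p * c t q) : ℤ) : ℂ) * (conj (w p) * w q) := by
  simp_rw [conj_linform_mul_linform, Finset.mul_sum]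
  rw [Finset.sum_comm]
  refine Finset.sum_congr rfl fun p _ => ?_
  rw [Finset.sum_comm]
  refine Finset.sum_congr rfl fun q _ => ?_
  push_cast
  rw [Finset.sum_mul]
  refine Finset.sum_congr rfl fun t _ => ?_
  ring

/-- Substituting an antisymmetrised variable into an integer linear form antisymmetrises its
coefficients (for an involution `e` of the index set). [folklore] -/
theorem linform_antisym {ι : Type} [Fintype ι] (e : ι ≃ ι) (he : ∀ p, e (e p) = p) (c : ι → ℤ)
    (w : ι → ℂ) :
    (∑ p, (c p : ℂ) * (w p - w (e p))) = ∑ p, ((c p - c (e p) : ℤ) : ℂ) * w p := by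
  have h1 : (∑ p, (c p : ℂ) * w (e p)) = ∑ p, (c (e p) : ℂ) * w p := by
    rw [← Equiv.sum_comp e (fun p => (c (e p) : ℂ) * w p)]
    simp only [he]
  simp only [mul_sub, Finset.sum_sub_distrib, h1]
  push_cast
  simp only [sub_mul, Finset.sum_sub_distrib]

/-- The square norm of an antisymmetrised variable as a Hermitian double sum. [folklore] -/
theorem sum_conj_mul_antisym {ι : Type} [Fintype ι] [DecidableEq ι] (e : ι ≃ ι)
    (he : ∀ p, e (e p) = p) (w : ι → ℂ) :
    (∑ p, conj (w p - w (e p)) * (w p - w (e p)))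
      = ∑ p, ∑ q, (((if p = q then 2 else 0) - (if q = e p then 2 else 0) : ℤ) : ℂ)
          * (conj (w p) * w q) := by
  -- right-hand side: `2 Σ |w p|² - 2 Σ conj (w p) w (e p)`
  have hR : (∑ p, ∑ q, (((if p = q then 2 else 0) - (if q = e p then 2 else 0) : ℤ) : ℂ)
        * (conj (w p) * w q))
      = ∑ p, (2 * (conj (w p) * w p) - 2 * (conj (w p) * w (e p))) := by
    refine Finset.sum_congr rfl fun p _ => ?_
    push_cast
    simp only [sub_mul, Finset.sum_sub_distrib, ite_mul, zero_mul, Finset.sum_ite_eq,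
      Finset.mem_univ, if_true]
    congr 1
    rw [Finset.sum_eq_single (e p)]
    · simp
    · intro q _ hq; rw [if_neg hq]
    · intro h; exact absurd (Finset.mem_univ _) h
  rw [hR]
  -- left-hand side: expand and reindex the two cross/shifted terms by the involution
  have h2 : (∑ p, conj (w (e p)) * w (e p)) = ∑ p, conj (w p) * w p := by
    rw [← Equiv.sum_comp e (fun p => conj (w (e p)) * w (e p))]
    simp only [he]
  have h3 : (∑ p, conj (w (e p)) * w p) = ∑ p, conj (w p) * w (e p) := by
    rw [← Equiv.sum_comp e (fun p => conj (w (e p)) * w p)]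
    simp only [he]
  have h4 : (∑ p, conj (w p - w (e p)) * (w p - w (e p)))
      = (∑ p, conj (w p) * w p) - (∑ p, conj (w p) * w (e p)) - (∑ p, conj (w (e p)) * w p)
        + ∑ p, conj (w (e p)) * w (e p) := by
    simp only [map_sub, ← Finset.sum_sub_distrib, ← Finset.sum_add_distrib]
    refine Finset.sum_congr rfl fun p _ => ?_
    ring
  rw [h4, h2, h3, Finset.sum_sub_distrib, ← Finset.mul_sum, ← Finset.mul_sum]
  ring

/-! ## The spectral gap of the slice contraction on alternating arrays -/

/-- The slice contraction as an integer linear form in all `64` coordinates. [folklore] -/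
theorem sliceMap_eq_linform (z : V64) (ca : P2 × P2) :
    sliceMap z ca = ∑ q : (P2 × P2) × P2,
      ((if q.2 = ca.2 ∧ (ca.1.1 = q.1.1.1 ∧ q.1.1.2 = q.1.2.1 ∧ ca.1.2 = q.1.2.2) then (1 : ℤ) else 0) : ℂ)
        * z q := by
  simp only [sliceMap, LinearMap.coe_mk, AddHom.coe_mk, T2_apply]
  conv_rhs => rw [Fintype.sum_prod_type]
  refine Finset.sum_congr rfl fun p _ => ?_
  rw [Finset.sum_eq_single ca.2]
  · by_cases h : (ca.1.1 = p.1.1 ∧ p.1.2 = p.2.1 ∧ ca.1.2 = p.2.2)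
    · rw [if_pos h, if_pos ⟨rfl, h⟩]; ring
    · rw [if_neg h, if_neg (fun h' => h h'.2)]; ring
  · intro a _ ha; rw [if_neg (fun h' => ha h'.1)]; ring
  · intro h; exact absurd (Finset.mem_univ _) h

/-- The inner product with a kernel vector as an integer linear form. [folklore] -/
theorem inner_kerVec_eq_linform (ws : Fin 2 × Fin 4) (z : V64) :
    ⟪kerVec ws, z⟫_ℂ = ∑ q : (P2 × P2) × P2, ((kerTab ws q : ℤ) : ℂ) * z q := by
  rw [inner_V64]
  refine Finset.sum_congr rfl fun q _ => ?_
  simp [kerVec_apply]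

/-- **Spectral gap of the slice contraction on alternating arrays.**  For an alternating array
`z` (antisymmetric in its two `A`-indices), the square distance to `kerSpan` is at most twice the
square norm of its slice contraction:
`‖z‖² - Σ |⟪n, z⟫|²/‖n‖² ≤ 2 · Σ_{c,a} |sliceMap z (c,a)|²`.
(The compression of `sliceMap* ∘ sliceMap` to the alternating arrays has spectrum `{0, 1/2, 3/2}`
with kernel `kerSpan`; the proof is the integer identity
`12·M_R − 6·M_I + M_N − M_top = 0` between `64 × 64` matrices, checked by `decide`, where `M_top`
is the Gram form of the four explicit top eigenvectors.) [folklore] -/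
theorem gap_core (z : V64) (hz : ∀ p : (P2 × P2) × P2, z ((p.2, p.1.2), p.1.1) = -z p) :
    ‖z‖ ^ 2 - ∑ ws : Fin 2 × Fin 4, ‖⟪kerVec ws, z⟫_ℂ‖ ^ 2 / (kerNsq ws : ℝ)
      ≤ 2 * ∑ ca : P2 × P2, ‖sliceMap z ca‖ ^ 2 := by
  -- the involution and the free variable `w = z / 2`
  let e : (P2 × P2) × P2 ≃ (P2 × P2) × P2 :=
    Equiv.mk (fun q => ((q.2, q.1.2), q.1.1)) (fun q => ((q.2, q.1.2), q.1.1)) (fun _ => rfl)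
      (fun _ => rfl)
  have he : ∀ p, e (e p) = p := fun _ => rfl
  set w : (P2 × P2) × P2 → ℂ := fun p => z p / 2 with hw
  have hzw : ∀ p, z p = w p - w (e p) := by
    intro p
    have h := hz p
    simp only [hw, e, Equiv.coe_fn_mk, h]
    ring
  -- integer coefficient tables
  let cR : P2 × P2 → (P2 × P2) × P2 → ℤ := fun ca q =>
    if q.2 = ca.2 ∧ (ca.1.1 = q.1.1.1 ∧ q.1.1.2 = q.1.2.1 ∧ ca.1.2 = q.1.2.2) then 1 else 0
  let topT : Fin 4 → (P2 × P2) × P2 → ℤ := fun s q =>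
    if s = 0 then (if q = (((0, 0), (0, 0)), (1, 0)) then (2 : ℤ) else if q = (((0, 0), (1, 0)), (1, 1)) then (1 : ℤ) else if q = (((0, 1), (1, 0)), (1, 0)) then (1 : ℤ) else if q = (((1, 0), (0, 0)), (0, 0)) then (-2 : ℤ) else if q = (((1, 0), (1, 0)), (0, 1)) then (-1 : ℤ) else if q = (((1, 1), (1, 0)), (0, 0)) then (-1 : ℤ) else 0)
    else if s = 1 then (if q = (((0, 0), (0, 1)), (1, 0)) then (2 : ℤ) else if q = (((0, 0), (1, 1)), (1, 1)) then (1 : ℤ) else if q = (((0, 1), (1, 1)), (1, 0)) then (1 : ℤ) else if q = (((1, 0), (0, 1)), (0, 0)) then (-2 : ℤ) else if q = (((1, 0), (1, 1)), (0, 1)) then (-1 : ℤ) else if q = (((1, 1), (1, 1)), (0, 0)) then (-1 : ℤ) else 0)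
    else if s = 2 then (if q = (((0, 0), (0, 0)), (1, 1)) then (1 : ℤ) else if q = (((0, 1), (0, 0)), (1, 0)) then (1 : ℤ) else if q = (((0, 1), (1, 0)), (1, 1)) then (2 : ℤ) else if q = (((1, 0), (0, 0)), (0, 1)) then (-1 : ℤ) else if q = (((1, 1), (0, 0)), (0, 0)) then (-1 : ℤ) else if q = (((1, 1), (1, 0)), (0, 1)) then (-2 : ℤ) else 0)
    else (if q = (((0, 0), (0, 1)), (1, 1)) then (1 : ℤ) else if q = (((0, 1), (0, 1)), (1, 0)) then (1 : ℤ) else if q = (((0, 1), (1, 1)), (1, 1)) then (2 : ℤ) else if q = (((1, 0), (0, 1)), (0, 1)) then (-1 : ℤ) else if q = (((1, 1), (0, 1)), (0, 0)) then (-1 : ℤ) else if q = (((1, 1), (1, 1)), (0, 1)) then (-2 : ℤ) else 0)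
  -- the integer matrix identity
  have key : ∀ p q : (P2 × P2) × P2,
      12 * (∑ ca : P2 × P2, (cR ca p - cR ca (e p)) * (cR ca q - cR ca (e q)))
        - (6 * ((if p = q then 2 else 0) - (if q = e p then 2 else 0)))
        + (∑ ws : Fin 2 × Fin 4, ((6 / kerNsq ws : ℕ) : ℤ) *
            ((kerTab ws p - kerTab ws (e p)) * (kerTab ws q - kerTab ws (e q))))
        - (∑ s : Fin 4, 1 * ((topT s p - topT s (e p)) * (topT s q - topT s (e q)))) = 0 := by
    decide +kernel
  -- the four pieces as linear forms in `w`
  have hL : ∀ ca, sliceMap z ca = ∑ q, ((cR ca q - cR ca (e q) : ℤ) : ℂ) * w q := by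
    intro ca
    rw [sliceMap_eq_linform]
    rw [← linform_antisym e he]
    refine Finset.sum_congr rfl fun q _ => ?_
    rw [hzw q]
    simp only [cR]
    push_cast
    ring
  have hK : ∀ ws, ⟪kerVec ws, z⟫_ℂ = ∑ q, ((kerTab ws q - kerTab ws (e q) : ℤ) : ℂ) * w q := by
    intro ws
    rw [inner_kerVec_eq_linform, ← linform_antisym e he]
    refine Finset.sum_congr rfl fun q _ => ?_
    rw [hzw q]
  have hI : (‖z‖ ^ 2 : ℂ) = ∑ p, ∑ q, (((if p = q then 2 else 0) - (if q = e p then 2 else 0) : ℤ) : ℂ)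
      * (conj (w p) * w q) := by
    rw [← sum_conj_mul_antisym e he w]
    have h1 : (‖z‖ ^ 2 : ℝ) = ∑ p, ‖z p‖ ^ 2 := norm_sq_V64 z
    have h2 : ((‖z‖ ^ 2 : ℝ) : ℂ) = ∑ p, ((‖z p‖ ^ 2 : ℝ) : ℂ) := by rw [h1]; push_cast; rfl
    have h3 : (‖z‖ ^ 2 : ℂ) = ((‖z‖ ^ 2 : ℝ) : ℂ) := by push_cast; rfl
    rw [h3, h2]
    refine Finset.sum_congr rfl fun p _ => ?_
    rw [← hzw p]
    exact_mod_cast (Complex.conj_mul' (z p)).symm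
  -- weights
  have hwt : ∀ ws : Fin 2 × Fin 4, ((6 / kerNsq ws : ℕ) : ℝ) * (kerNsq ws : ℝ) = 6 := by
    intro ws
    unfold kerNsq
    split_ifs <;> norm_num
  -- assemble the complex identity `Σ 12|L|² + Σ (6/N)|K|² = 6‖z‖² + Σ |T|²`
  have hC : (∑ ca, ((12 : ℤ) : ℂ) * (conj (sliceMap z ca) * sliceMap z ca))
      + (∑ ws, (((6 / kerNsq ws : ℕ) : ℤ) : ℂ) * (conj ⟪kerVec ws, z⟫_ℂ * ⟪kerVec ws, z⟫_ℂ))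
      = 6 * (‖z‖ ^ 2 : ℂ)
        + ∑ s, ((1 : ℤ) : ℂ) * (conj (∑ q, ((topT s q - topT s (e q) : ℤ) : ℂ) * w q)
            * (∑ q, ((topT s q - topT s (e q) : ℤ) : ℂ) * w q)) := by
    simp_rw [hL, hK]
    rw [hI, sum_weight_conj_linform_mul_linform, sum_weight_conj_linform_mul_linform,
      sum_weight_conj_linform_mul_linform, Finset.mul_sum]
    simp only [Finset.mul_sum, ← Finset.sum_add_distrib]
    refine Finset.sum_congr rfl fun p _ => Finset.sum_congr rfl fun q _ => ?_
    have hk := key p q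
    have hk2 : ((∑ ca : P2 × P2, 12 * ((cR ca p - cR ca (e p)) * (cR ca q - cR ca (e q))))
        + (∑ ws : Fin 2 × Fin 4, ((6 / kerNsq ws : ℕ) : ℤ) *
            ((kerTab ws p - kerTab ws (e p)) * (kerTab ws q - kerTab ws (e q)))) : ℤ)
        = 6 * ((if p = q then 2 else 0) - (if q = e p then 2 else 0))
          + ∑ s : Fin 4, 1 * ((topT s p - topT s (e p)) * (topT s q - topT s (e q))) := by
      rw [← Finset.mul_sum]; linarith
    have hk3 : ((∑ ca : P2 × P2, 12 * ((cR ca p - cR ca (e p)) * (cR ca q - cR ca (e q))) : ℤ) : ℂ)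
        + ((∑ ws : Fin 2 × Fin 4, ((6 / kerNsq ws : ℕ) : ℤ) *
            ((kerTab ws p - kerTab ws (e p)) * (kerTab ws q - kerTab ws (e q))) : ℤ) : ℂ)
        = 6 * (((if p = q then 2 else 0) - (if q = e p then 2 else 0) : ℤ) : ℂ)
          + ((∑ s : Fin 4, 1 * ((topT s p - topT s (e p)) * (topT s q - topT s (e q))) : ℤ) : ℂ) := by
      exact_mod_cast hk2
    linear_combination (conj (w p) * w q) * hk3
  -- take real parts: every term is `‖·‖²`
  have hreal : (∑ ca, (12 : ℝ) * ‖sliceMap z ca‖ ^ 2)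
      + (∑ ws, ((6 / kerNsq ws : ℕ) : ℝ) * ‖⟪kerVec ws, z⟫_ℂ‖ ^ 2)
      = 6 * ‖z‖ ^ 2 + ∑ s, ‖∑ q, ((topT s q - topT s (e q) : ℤ) : ℂ) * w q‖ ^ 2 := by
    have h := hC
    simp only [Complex.conj_mul', Int.cast_one, one_mul] at h
    exact_mod_cast h
  have htop : 0 ≤ ∑ s, ‖∑ q, ((topT s q - topT s (e q) : ℤ) : ℂ) * w q‖ ^ 2 :=
    Finset.sum_nonneg fun s _ => by positivity
  have hKN : (∑ ws, ((6 / kerNsq ws : ℕ) : ℝ) * ‖⟪kerVec ws, z⟫_ℂ‖ ^ 2)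
      = 6 * ∑ ws : Fin 2 × Fin 4, ‖⟪kerVec ws, z⟫_ℂ‖ ^ 2 / (kerNsq ws : ℝ) := by
    rw [Finset.mul_sum]
    refine Finset.sum_congr rfl fun ws _ => ?_
    have hpos : (0 : ℝ) < kerNsq ws := by exact_mod_cast kerNsq_pos ws
    have h := hwt ws
    field_simp
    nlinarith [h]
  have hL12 : (∑ ca, (12 : ℝ) * ‖sliceMap z ca‖ ^ 2) = 12 * ∑ ca, ‖sliceMap z ca‖ ^ 2 := by
    rw [Finset.mul_sum]
  rw [hKN, hL12] at hreal
  nlinarith [hreal, htop]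

/-- **The gap inequality for `kerProj`.**  For an alternating array `z`:
`‖z - kerProj z‖² ≤ 2 · Σ_{c,a} |sliceMap z (c,a)|²`. [folklore] -/
theorem norm_sq_sub_kerProj_le (z : V64) (hz : ∀ p : (P2 × P2) × P2, z ((p.2, p.1.2), p.1.1) = -z p) :
    ‖z - kerProj z‖ ^ 2 ≤ 2 * ∑ ca : P2 × P2, ‖sliceMap z ca‖ ^ 2 := by
  rw [norm_sq_sub_kerProj, norm_sq_kerProj]
  exact gap_core z hz

end Summit.MatrixMultiplication.MatrixMultiplication.Theorems.GapTwoSixExplicit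

end
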